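import Literature.MathematicalPhysics.QuantumFieldTheory.ChengWuTheorem
import Literature.MathematicalPhysics.QuantumFieldTheory.Borinsky2020.HeppSectorDecomposition
import Literature.MathematicalPhysics.QuantumFieldTheory.Borinsky2020.ConeIntegral
import HarnessLib

/-!
# Binoth–Heinrich 2000, Part I «Generation of primary sectors» WITH the δ-function: `G = Σ_{l=1}^N G_l`, `G_l = ∫_0^1 d^{N−1}t 𝒰_l^{N−(L+1)D/2}/ℱ_l^{N−LD/2}` (eq. (EQ:primary_sectors)) — PROVED, for every non-negative integrand homogeneous of degree `−N`

Source [BinothHeinrich2000]: T. Binoth, G. Heinrich, "An automatized algorithm to compute infrared divergent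
multi-loop integrals", Nucl. Phys. B 585 (2000) 741–759, doi:10.1016/s0550-3213(00)00429-6 = arXiv:hep-ph/0004013
(v2; e-print source `sd_replaced170701.tex` deposited on the pub-qed HOME, `data/lit/sources/.cache/hep-ph_0004013/`).
The SECTOR identity of Part I — "∫_0^∞ dᴺx = Σ_{l=1}^N ∫_0^∞ dᴺx Π_{j≠l} θ(x_l ≥ x_j ≥ 0)" for any measure `≪ λᴺ` — is
typed in `Borinsky2020/HeppSectorDecomposition.lean` (`primarySector`, `integral_eq_sum_integral_primarySector`); Part II's
step in `BinothHeinrich2000/IteratedSectorStep.lean`; Part III in `BinothHeinrich2000/PoleExtraction.lean`. THIS file types the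
remaining half of Part I: the δ-function `δ(1 − Σ_l x_l)` of eq. (EQ:param_rep) and the substitution `x_j = x_l t_j` that turns each
primary sector into the unit cube ("we integrate out x_l by using the δ-distribution"). **Part I, VERBATIM** (arXiv v2 p. 4–5; tex
l.322–368): «In the first part of the algorithm we split the integration domain into N parts and eliminate the δ–distribution in
such a way that the remaining integrations are from 0 to 1. To this end we decompose the integration range as follows
  ∫_0^∞ dᴺx = ∫_0^∞ dᴺx Π_{j=1}^N θ(x_j ≥ 0) = Σ_{l=1}^N ∫_0^∞ dᴺx Π_{j=1, j≠l}^N θ(x_l ≥ x_j ≥ 0)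
where the θ-function is defined as θ(x ≥ y) = 1 if x ≥ y is true, 0 otherwise. The integral is now split into N domains
corresponding to N integrals G_l from which we extract a common factor: G = (−1)^N Γ(N−LD/2) Σ_{l=1}^N G_l. In the integrals G_l
we integrate out x_l by using the δ–distribution after having done the substitution
  x_j = x_l t_j (j < l), x_l (j = l), x_l t_{j−1} (j > l).
Because of homogeneity, x_l factorizes completely in the functions 𝒰(x) → 𝒰_l(t) x_l^L and ℱ(x) → ℱ_l(t) x_l^{L+1} and thus,
using ∫ dx_l/x_l δ(1 − x_l(1 + Σ_{k=1}^{N−1} t_k)) = 1, one obtains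
  (EQ:primary_sectors)  G_l = ∫_0^1 d^{N−1}t 𝒰_l^{N−(L+1)D/2} / ℱ_l^{N−LD/2}, l = 1, …, N.
Note that the singular behaviour leading to ε–poles still comes from the regions of small t's. This feature would be lost if one
integrated out the δ–distribution in a naive way, since this would produce poles at upper limits of the parameter integral as
well. The generated sectors will be called primary sectors in the following. The functions 𝒰_l and ℱ_l are polynomials in the
parameters t_j.» With eq. (EQ:param_rep) (l.254–258): «G = (−1)^N Γ(N−LD/2) ∫_0^∞ dᴺx δ(1 − Σ_{l=1}^N x_l)
𝒰(x)^{N−(L+1)D/2} / ℱ(x)^{N−LD/2}».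

TYPING. `N = m + 1` parameters `x : Fin (m + 1) → ℝ`; the integrand is an ABSTRACT measurable `F : ℝ^N → ℝ≥0∞` (the printed
`𝒰^{N−(L+1)D/2}/ℱ^{N−LD/2}`, non-negative in the Euclidean region «ℱ of definite sign»; extended-real valued so that no integrability
hypothesis is needed — both sides may be `∞` together) which is HOMOGENEOUS OF DEGREE `−N` on the open orthant,
`F(c x) = c^{−N} F(x)` — exactly what «Because of homogeneity, x_l factorizes completely … 𝒰 → 𝒰_l x_l^L, ℱ → ℱ_l x_l^{L+1}» delivers
for the printed integrand (`integrand_smul_eq`: `L(N−(L+1)D/2) − (L+1)(N−LD/2) = −N`, any real `D`). The δ-function integral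
`∫ dᴺx δ(1 − Σ x_l) F` is written, as in the companion `ChengWuTheorem.lean`, with the delta function RESOLVED in a variable `x_j`:
`∫⁻_{y>0, Σy<1} F(x_j = 1 − Σ y, rest = y) dy` (the standard simplex in the coordinates `(x_i)_{i≠j}`; by Cheng–Wu the value does not
depend on `j`). The substitution `x_j = x_l t_j (j<l), x_l (j=l), x_l t_{j−1} (j>l)` with `x_l = 1` IS Mathlib's
`Fin.insertNth l 1 t`, so `𝒰_l(t) = 𝒰(Fin.insertNth l 1 t)`; the cube `∫_0^1 d^{N−1}t` is the open `unitCube m` of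
`Borinsky2020/ConeIntegral.lean` (= `(0,1)^{N−1}`; the closed `Set.Icc 0 1` form is a corollary, null boundary); the primary sector is
`Borinsky2020.primarySector l = {x | ∀ j, x j ≤ x l}`. NO new definition (D-0026). The overall factor `(−1)^N Γ(N−LD/2)` and the
loop-momentum origin of (EQ:param_rep) are not part of the statement.

PROOF ROUTE (the printed one, the δ-function handled by the companion's Cheng–Wu identities instead of a formal δ): (1) on the chart
`x_l = 1` the sector condition `x_j ≤ x_l` reads `t_j ≤ 1`, so `∫⁻_{t>0} (𝟙_{P_l}F)(x_l = 1, t) dt = ∫⁻_{(0,1]^m} F(x_l = 1, t) dt`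
(`lintegral_indicator_primarySector_chart`; `(0,1]^m` a.e. `= (0,1)^m`); (2) `𝟙_{P_l} F` is still homogeneous of degree `−N` (the sector is
a cone), so Cheng–Wu (`chengWu_lintegral_simplex_eq_chart`: simplex chart = chart `x_l = 1` for degree-`−N` integrands — this is
«we integrate out x_l by using the δ–distribution … using ∫ dx_l/x_l δ(1 − x_l(1 + Σ t_k)) = 1») gives the ONE-SECTOR identity
`lintegral_simplex_primarySector_eq_lintegral_unitCube`; (3) for the SUM, the smeared form `∫⁻_{x>0} F(x) φ(Σx) dx = (∫φ(u)du/u)·∫_Δ F`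
(`chengWu_lintegral_smear_simplex`, `chengWu_lintegral_smear`, with the weight `φ(u) = u·𝟙_{(0,1)}(u)` of unit `du/u`-mass) moves the
statement to the full orthant, where «∫_0^∞ dᴺx = Σ_l ∫ Π_{j≠l} θ(x_l ≥ x_j ≥ 0)» holds off the Lebesgue-null ties
(`Borinsky2020.sum_indicator_primarySector`, `ae_injective`), and back.

PROVED (0 named facts, 0 definitions; Mathlib + `ChengWuTheorem.lean` + `Borinsky2020/HeppSectorDecomposition.lean` +
`Borinsky2020/ConeIntegral.lean`):
* `integrand_smul_eq` — «Because of homogeneity»: `𝒰` of degree `L`, `ℱ` of degree `L+1`, positive on the orthant ⇒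
  `(𝒰^{N−(L+1)D/2}/ℱ^{N−LD/2})(c x) = (c^N)⁻¹ (𝒰^{N−(L+1)D/2}/ℱ^{N−LD/2})(x)` for every real `D`;
* `indicator_primarySector_smul` (the sector is a cone), `indicator_primarySector_insertNth` (`x_j ≤ x_l` ↔ `t_j ≤ 1` in the chart),
  `lintegral_indicator_primarySector_chart`;
* **`lintegral_simplex_primarySector_eq_lintegral_unitCube`** — ONE primary sector: `∫⁻_{Δ ∩ P_l} F = ∫⁻_{(0,1)^{N−1}} F(x_l = 1, t) dt =: G_l`
  (eq. (EQ:primary_sectors), delta function resolved in any `x_j`);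
* **`lintegral_simplex_eq_sum_lintegral_unitCube`** — «G = Σ_{l=1}^N G_l»: `∫⁻_Δ F = Σ_l ∫⁻_{(0,1)^{N−1}} F(x_l = 1, t) dt`, and
  **`lintegral_simplex_eq_sum_lintegral_Icc`** — the same with the printed closed cube `[0,1]^{N−1}`.
NOT typed: the loop-momentum derivation of (EQ:param_rep) and its prefactor `(−1)^N Γ(N−LD/2)` (and `Γ(N)` of (EQ_mixed_rep)); the
polynomials `𝒰 = det M`, `ℱ = det(M)[J − Q·Q M⁻¹]` themselves (any homogeneous `F ≥ 0` is allowed — the Kirchhoff/Symanzik polynomials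
of a graph are `CycleMatroidSpanningTrees.lean` / `MatrixTreeTheorem.lean` material, not assembled here); REAL-valued (signed) or
complex (dimensionally regularised, `ε ∈ ℂ`) integrands — the identity is typed for `ℝ≥0∞`-valued `F` (for an integrable real `F ≥ 0` it
is the same statement read through `ENNReal.ofReal`); the remark «the singular behaviour … still comes from the regions of small t's»
(a statement about where `𝒰_l`, `ℱ_l` vanish — Part II's input, `IteratedSectorStep.eval_remap_eq_mul_of_vanishing`); anything on signed
sums of sector integrals. Filed by the pub-qed TROPICAL literature seat `pub-qed-trop-lit` gen 28 as the kernel object behind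
`tropical/lit/SOURCES.md` §4.2 (A30); VALUE-FREE (identities about integrals of an abstract homogeneous function; nothing per graph,
word or class); independent recomputation; certified where stated, statistical where stated; no new-physics claim.
-/

noncomputable section

namespace Literature.MathematicalPhysics.QuantumFieldTheory.BinothHeinrich2000

open MeasureTheory Set Real Finset
open scoped ENNReal
open Literature.MathematicalPhysics.QuantumFieldTheory.Borinsky2020

variable {m : ℕ}

/-! ## Homogeneity of the integrand `𝒰^{N−(L+1)D/2}/ℱ^{N−LD/2}` -/

/-- **"Because of homogeneity, x_l factorizes completely in the functions 𝒰(x) → 𝒰_l(t) x_l^L and ℱ(x) → ℱ_l(t) x_l^{L+1}"** —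
the consequence used by Part I: if `𝒰` is homogeneous of degree `L` and `ℱ` of degree `L + 1`, both positive on the open orthant,
then the integrand `𝒰^{N−(L+1)D/2}/ℱ^{N−LD/2}` of eq. (EQ:param_rep) is homogeneous of degree `−N`
(`L(N−(L+1)D/2) − (L+1)(N−LD/2) = −N` for every real `D`). [cite: BinothHeinrich2000, Part I (tex l.351–358); §2 eq. (EQ:param_rep) (l.254–258)] -/
theorem integrand_smul_eq {N L : ℕ} {D : ℝ} {U F : (Fin N → ℝ) → ℝ}
    (hU : ∀ c : ℝ, 0 < c → ∀ x : Fin N → ℝ, (∀ i, 0 < x i) → U (c • x) = c ^ L * U x)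
    (hF : ∀ c : ℝ, 0 < c → ∀ x : Fin N → ℝ, (∀ i, 0 < x i) → F (c • x) = c ^ (L + 1) * F x)
    (hUpos : ∀ x : Fin N → ℝ, (∀ i, 0 < x i) → 0 < U x) (hFpos : ∀ x : Fin N → ℝ, (∀ i, 0 < x i) → 0 < F x)
    {c : ℝ} (hc : 0 < c) {x : Fin N → ℝ} (hx : ∀ i, 0 < x i) :
    U (c • x) ^ ((N : ℝ) - (L + 1) * D / 2) / F (c • x) ^ ((N : ℝ) - L * D / 2) =
      (c ^ N)⁻¹ * (U x ^ ((N : ℝ) - (L + 1) * D / 2) / F x ^ ((N : ℝ) - L * D / 2)) := by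
  rw [hU c hc x hx, hF c hc x hx, Real.mul_rpow (pow_nonneg hc.le _) (hUpos x hx).le,
    Real.mul_rpow (pow_nonneg hc.le _) (hFpos x hx).le]
  have h1 : (c ^ L : ℝ) ^ ((N : ℝ) - (L + 1) * D / 2) = c ^ ((L : ℝ) * ((N : ℝ) - (L + 1) * D / 2)) := by
    rw [← Real.rpow_natCast c L, ← Real.rpow_mul hc.le]
  have h2 : (c ^ (L + 1) : ℝ) ^ ((N : ℝ) - L * D / 2) = c ^ (((L : ℝ) + 1) * ((N : ℝ) - L * D / 2)) := by
    rw [← Real.rpow_natCast c (L + 1), ← Real.rpow_mul hc.le]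
    norm_num
  have h3 : (c ^ N : ℝ)⁻¹ = c ^ (-(N : ℝ)) := by
    rw [Real.rpow_neg hc.le, Real.rpow_natCast]
  rw [h1, h2, h3, mul_div_mul_comm, ← Real.rpow_sub hc]
  congr 1
  congr 1
  ring

/-! ## Part I: the δ-function integral over a primary sector is a unit-cube integral in the chart `x_l = 1` -/

/-- The primary sector `{x_l ≥ x_j ∀ j}` is a cone: its indicator times a function homogeneous of degree `−(m+1)` is again homogeneous
of degree `−(m+1)` on the open orthant. Plumbing. [cite: BinothHeinrich2000, Part I (tex l.322–333)] -/
theorem indicator_primarySector_smul (l : Fin (m + 1)) {F : (Fin (m + 1) → ℝ) → ℝ≥0∞}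
    (hF : ∀ c : ℝ, 0 < c → ∀ x : Fin (m + 1) → ℝ, (∀ i, 0 < x i) →
      F (c • x) = ENNReal.ofReal ((c ^ (m + 1))⁻¹) * F x)
    (c : ℝ) (hc : 0 < c) (x : Fin (m + 1) → ℝ) (hx : ∀ i, 0 < x i) :
    (primarySector l).indicator F (c • x) = ENNReal.ofReal ((c ^ (m + 1))⁻¹) * (primarySector l).indicator F x := by
  have hmem : c • x ∈ primarySector l ↔ x ∈ primarySector l := by
    simp only [mem_primarySector, Pi.smul_apply, smul_eq_mul]
    exact ⟨fun h j => le_of_mul_le_mul_left (h j) hc, fun h j => mul_le_mul_of_nonneg_left (h j) hc.le⟩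
  by_cases h : x ∈ primarySector l
  · rw [Set.indicator_of_mem (hmem.mpr h), Set.indicator_of_mem h, hF c hc x hx]
  · rw [Set.indicator_of_notMem (fun h' => h (hmem.mp h')), Set.indicator_of_notMem h, mul_zero]

/-- In the chart `x_l = 1` the primary sector `{x_l ≥ x_j ∀ j}` reads `{t_j ≤ 1 ∀ j}` ("substitute x_j = x_l t_j … t_j ≤ 1"):
on the open orthant of the chart, `𝟙_{P_l}(x_l = 1, rest = t) · F = 𝟙_{t ≤ 1} · F(x_l = 1, rest = t)`. Plumbing.
[cite: BinothHeinrich2000, Part I (tex l.341–358)] -/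
theorem indicator_primarySector_insertNth (l : Fin (m + 1)) (F : (Fin (m + 1) → ℝ) → ℝ≥0∞) (t : Fin m → ℝ) :
    (primarySector l).indicator F (Fin.insertNth l (1 : ℝ) t) =
      {t : Fin m → ℝ | ∀ i, t i ≤ 1}.indicator (fun t => F (Fin.insertNth l (1 : ℝ) t)) t := by
  have hmem : (Fin.insertNth l (1 : ℝ) t : Fin (m + 1) → ℝ) ∈ primarySector l ↔ t ∈ {t : Fin m → ℝ | ∀ i, t i ≤ 1} := by
    rw [mem_primarySector, Fin.forall_iff_succAbove l]
    simp [Fin.insertNth_apply_same, Fin.insertNth_apply_succAbove]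
  by_cases h : t ∈ {t : Fin m → ℝ | ∀ i, t i ≤ 1}
  · rw [Set.indicator_of_mem (hmem.mpr h), Set.indicator_of_mem h]
  · rw [Set.indicator_of_notMem (fun h' => h (hmem.mp h')), Set.indicator_of_notMem h]

/-- The chart integral of `𝟙_{P_l} F` over the open orthant is the integral of `F(x_l = 1, ·)` over the unit cube
(`{t > 0} ∩ {t ≤ 1} = (0,1]^m`, a.e. `= (0,1)^m`). Plumbing. [cite: BinothHeinrich2000, Part I, eq. (EQ:primary_sectors) (tex l.355–358)] -/
theorem lintegral_indicator_primarySector_chart (l : Fin (m + 1)) (F : (Fin (m + 1) → ℝ) → ℝ≥0∞) :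
    ∫⁻ t in {t : Fin m → ℝ | ∀ i, 0 < t i}, (primarySector l).indicator F (Fin.insertNth l (1 : ℝ) t) =
      ∫⁻ t in unitCube m, F (Fin.insertNth l (1 : ℝ) t) := by
  simp_rw [indicator_primarySector_insertNth l F]
  have hmeas : MeasurableSet {t : Fin m → ℝ | ∀ i, t i ≤ 1} := by
    have h : {t : Fin m → ℝ | ∀ i, t i ≤ 1} = ⋂ i, {t : Fin m → ℝ | t i ≤ 1} := by ext t; simp
    rw [h]
    exact MeasurableSet.iInter fun i => measurableSet_le (measurable_pi_apply i) measurable_const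
  rw [lintegral_indicator hmeas, Measure.restrict_restrict hmeas]
  have hset : ({t : Fin m → ℝ | ∀ i, t i ≤ 1} ∩ {t : Fin m → ℝ | ∀ i, 0 < t i} : Set (Fin m → ℝ)) =
      Set.univ.pi fun _ => Ioc (0 : ℝ) 1 := by
    ext t
    simp only [Set.mem_inter_iff, Set.mem_setOf_eq, Set.mem_univ_pi, Set.mem_Ioc]
    exact ⟨fun h i => ⟨h.2 i, h.1 i⟩, fun h => ⟨fun i => (h i).2, fun i => (h i).1⟩⟩
  rw [hset]
  refine setLIntegral_congr ?_
  rw [unitCube, volume_pi]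
  exact (Measure.pi_Ioo_ae_eq_pi_Ioc (f := fun _ => (0 : ℝ)) (g := fun _ => (1 : ℝ))).symm

/-- **Part I, ONE primary sector, with the δ-function (eq. (EQ:primary_sectors))**: for `F ≥ 0` measurable and homogeneous of degree
`−N` on the open orthant of `ℝ^N` (`N = m + 1`; e.g. `𝒰^{N−(L+1)D/2}/ℱ^{N−LD/2}`, `integrand_smul_eq`), the part of the projective
integral `∫ dᴺx δ(1 − Σ_i x_i) F(x)` — the delta function resolved in the variable `x_j`, i.e. the standard simplex in the coordinates
`(x_i)_{i≠j}` — that lies in the primary sector `Π_{i≠l} θ(x_l ≥ x_i)` equals the UNIT-CUBE integral in the chart `x_l = 1`: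
"G_l = ∫_0^1 d^{N−1}t 𝒰_l^{N−(L+1)D/2}(t)/ℱ_l^{N−LD/2}(t)" with `𝒰_l(t) = 𝒰(x_l = 1, rest = t)`. The printed substitution
`x_j = x_l t_j` and "integrating out x_l" with the δ-function is the Cheng–Wu change of chart of the companion `ChengWuTheorem.lean`.
[cite: BinothHeinrich2000, Part I (tex l.322–358) (= Nucl. Phys. B 585 (2000) 741 §2 Part I; arXiv hep-ph/0004013v2 p. 4–5)] -/
theorem lintegral_simplex_primarySector_eq_lintegral_unitCube (j l : Fin (m + 1)) {F : (Fin (m + 1) → ℝ) → ℝ≥0∞}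
    (hFm : Measurable F)
    (hF : ∀ c : ℝ, 0 < c → ∀ x : Fin (m + 1) → ℝ, (∀ i, 0 < x i) →
      F (c • x) = ENNReal.ofReal ((c ^ (m + 1))⁻¹) * F x) :
    ∫⁻ y in {y : Fin m → ℝ | (∀ i, 0 < y i) ∧ ∑ i, y i < 1},
        (primarySector l).indicator F (Fin.insertNth j (1 - ∑ i, y i) y) =
      ∫⁻ t in unitCube m, F (Fin.insertNth l (1 : ℝ) t) := by
  rw [chengWu_lintegral_simplex_eq_chart j l (hFm.indicator (measurableSet_primarySector l))
    (indicator_primarySector_smul l hF)]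
  exact lintegral_indicator_primarySector_chart l F

/-- **Part I with the δ-function: "G = Σ_{l=1}^{N} G_l" (eqs. (EQ:param_rep) → (EQ:primary_sectors))**: for `F ≥ 0` measurable and
homogeneous of degree `−N` on the open orthant, the projective integral `∫ dᴺx δ(1 − Σ x_i) F(x)` (delta function resolved in any
variable `x_j`) is the sum over the `N` primary sectors of the unit-cube integrals in the charts `x_l = 1`:
`∫_{Δ} F = Σ_l ∫_{(0,1)^{N−1}} F(x_l = 1, rest = t) dt` — "∫_0^∞ dᴺx = Σ_{l=1}^N ∫_0^∞ dᴺx Π_{j≠l} θ(x_l ≥ x_j ≥ 0) … The N-dimensional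
x-integral over a sector … is transformed to the (N−1)-dimensional cube through the transformation of variables x_j = x_l t_j …
G = Σ_l G_l, G_l = ∫_0^1 d^{N−1}t 𝒰_l^{N−(L+1)D/2}/ℱ_l^{N−LD/2}". Proof as printed, with the δ-function handled by the smeared
Cheng–Wu identity of `ChengWuTheorem.lean` (insert `1 = ∫ dt δ(t − Σx)`, decompose the orthant into primary sectors off the null
ties, change chart sector by sector). [cite: BinothHeinrich2000, Part I (tex l.322–358), eq. (EQ:primary_sectors) (l.355–358); eq. (EQ:param_rep) (l.254–258)] -/
theorem lintegral_simplex_eq_sum_lintegral_unitCube (j : Fin (m + 1)) {F : (Fin (m + 1) → ℝ) → ℝ≥0∞}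
    (hFm : Measurable F)
    (hF : ∀ c : ℝ, 0 < c → ∀ x : Fin (m + 1) → ℝ, (∀ i, 0 < x i) →
      F (c • x) = ENNReal.ofReal ((c ^ (m + 1))⁻¹) * F x) :
    ∫⁻ y in {y : Fin m → ℝ | (∀ i, 0 < y i) ∧ ∑ i, y i < 1}, F (Fin.insertNth j (1 - ∑ i, y i) y) =
      ∑ l : Fin (m + 1), ∫⁻ t in unitCube m, F (Fin.insertNth l (1 : ℝ) t) := by
  -- the smearing weight `φ(u) = u · 𝟙_{(0,1)}(u)`, normalised so that `∫_0^∞ φ(u) du/u = 1`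
  set φ : ℝ → ℝ≥0∞ := fun u => (Ioo (0 : ℝ) 1).indicator (fun u => ENNReal.ofReal u) u with hφ
  have hφm : Measurable φ := (ENNReal.measurable_ofReal).indicator measurableSet_Ioo
  have hC : ∫⁻ u in Ioi (0 : ℝ), φ u / ENNReal.ofReal u = 1 := by
    have hcong : ∀ u ∈ Ioi (0 : ℝ), φ u / ENNReal.ofReal u = (Ioo (0 : ℝ) 1).indicator 1 u := by
      intro u hu
      simp only [hφ]
      by_cases h : u ∈ Ioo (0 : ℝ) 1
      · rw [Set.indicator_of_mem h, Set.indicator_of_mem h, Pi.one_apply,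
          ENNReal.div_self (ne_of_gt (ENNReal.ofReal_pos.mpr hu)) ENNReal.ofReal_ne_top]
      · rw [Set.indicator_of_notMem h, Set.indicator_of_notMem h, ENNReal.zero_div]
    rw [setLIntegral_congr_fun measurableSet_Ioi hcong, lintegral_indicator_one measurableSet_Ioo,
      Measure.restrict_apply measurableSet_Ioo, Set.Ioo_inter_Ioi, max_eq_left le_rfl, Real.volume_Ioo]
    simp
  -- the gauge `h = Σ_i x_i`
  have hhm : Measurable fun x : Fin (m + 1) → ℝ => ∑ i, x i := Finset.measurable_sum _ fun i _ => measurable_pi_apply i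
  have hh : ∀ c : ℝ, 0 < c → ∀ x : Fin (m + 1) → ℝ, (∀ i, 0 < x i) → (∑ i, (c • x) i) = c * ∑ i, x i := by
    intro c _ x _
    simp [Finset.mul_sum]
  have hpos : ∀ x : Fin (m + 1) → ℝ, (∀ i, 0 < x i) → 0 < ∑ i, x i := fun x hx =>
    Finset.sum_pos (fun i _ => hx i) Finset.univ_nonempty
  -- smeared identity for `F` (simplex chart) and for each `𝟙_{P_l} F` (chart `x_l = 1`)
  have hsmear := chengWu_lintegral_smear_simplex j hFm hF hφm
  rw [hC, one_mul] at hsmear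
  have hsmear_l : ∀ l : Fin (m + 1),
      ∫⁻ x in {x : Fin (m + 1) → ℝ | ∀ i, 0 < x i}, (primarySector l).indicator F x * φ (∑ i, x i) =
        ∫⁻ t in unitCube m, F (Fin.insertNth l (1 : ℝ) t) := by
    intro l
    rw [chengWu_lintegral_smear l (hFm.indicator (measurableSet_primarySector l)) (indicator_primarySector_smul l hF)
      hhm hh hpos hφm, hC, one_mul]
    exact lintegral_indicator_primarySector_chart l F
  -- the primary sectors partition the orthant off the null ties
  have hμ : ((volume : Measure (Fin (m + 1) → ℝ)).restrict {x : Fin (m + 1) → ℝ | ∀ i, 0 < x i}) ≪ volume :=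
    Measure.absolutelyContinuous_of_le Measure.restrict_le_self
  have hae : (fun x => ∑ l : Fin (m + 1), (primarySector l).indicator F x * φ (∑ i, x i)) =ᵐ[
      (volume : Measure (Fin (m + 1) → ℝ)).restrict {x : Fin (m + 1) → ℝ | ∀ i, 0 < x i}]
      fun x => F x * φ (∑ i, x i) := by
    filter_upwards [ae_injective hμ] with x hx
    rw [← Finset.sum_mul, sum_indicator_primarySector hx F]
  have hmeas : ∀ l : Fin (m + 1), Measurable fun x : Fin (m + 1) → ℝ => (primarySector l).indicator F x * φ (∑ i, x i) :=
    fun l => (hFm.indicator (measurableSet_primarySector l)).mul (hφm.comp hhm)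
  rw [← hsmear, ← lintegral_congr_ae hae,
    lintegral_finsetSum Finset.univ (f := fun (l : Fin (m + 1)) (x : Fin (m + 1) → ℝ) =>
      (primarySector l).indicator F x * φ (∑ i, x i)) fun l _ => hmeas l]
  exact Finset.sum_congr rfl fun l _ => hsmear_l l

/-- The same with the closed cube `[0,1]^{N−1}` of the print ("∫_0^1 d^{N−1}t"; the boundary is Lebesgue-null).
[cite: BinothHeinrich2000, Part I, eq. (EQ:primary_sectors) (tex l.355–358)] -/
theorem lintegral_simplex_eq_sum_lintegral_Icc (j : Fin (m + 1)) {F : (Fin (m + 1) → ℝ) → ℝ≥0∞}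
    (hFm : Measurable F)
    (hF : ∀ c : ℝ, 0 < c → ∀ x : Fin (m + 1) → ℝ, (∀ i, 0 < x i) →
      F (c • x) = ENNReal.ofReal ((c ^ (m + 1))⁻¹) * F x) :
    ∫⁻ y in {y : Fin m → ℝ | (∀ i, 0 < y i) ∧ ∑ i, y i < 1}, F (Fin.insertNth j (1 - ∑ i, y i) y) =
      ∑ l : Fin (m + 1), ∫⁻ t in Set.Icc (0 : Fin m → ℝ) 1, F (Fin.insertNth l (1 : ℝ) t) := by
  rw [lintegral_simplex_eq_sum_lintegral_unitCube j hFm hF]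
  refine Finset.sum_congr rfl fun l _ => setLIntegral_congr ?_
  rw [unitCube, volume_pi]
  exact Measure.univ_pi_Ioo_ae_eq_Icc (f := fun _ => (0 : ℝ)) (g := fun _ => (1 : ℝ))

end Literature.MathematicalPhysics.QuantumFieldTheory.BinothHeinrich2000

end
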